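import Summits.QuantumFields.YangMills.Theorems.ToronValleyVolumeLojasiewiczLocaliseRing
import Summits.QuantumFields.YangMills.Theorems.VirialFluxGapCombConstantDeficit
import HarnessLib

/-!
# Route `VirialFluxGap` (YangMills): the COMB SHADOW of a ring history — exponent-ONE proximity to the comb-constant family and the
# polynomial cost of the shadow (central coercivity, part I; free-hands helper toward crux ⟨stmt-QuantumFields-24141⟩ `PeriodicSoftness`)

Width seat `ym-line-sfw-p2-w3` g59 (cell ym-idea-1, free hands; own crux ⟨22884⟩ has no free stub), `--supports stmt-QuantumFields-24141`.

The CENTRAL chart (C1) of the Euler field for ⟨24141⟩ (LEAD notes №4–№6 on the ym-idea-1 bus) needs a COERCIVITY of the periodic deficit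
`F₀ = ringDeficit L 0` near the sixteen central torons of the tree-gauged host `X_fix`: `F₀(P) ≳ poly(L)⁻¹·(‖P − π_C P‖² + Q(z(P)))`, where
`π_C` is the central projection onto the 12-dimensional COMB-CONSTANT family `C = {((fun _ => combFlat h), fun _ => c)}` (✓`CombConstant`,
✓`FrameDerivative.centralProj`) and `Q` its commutator quartic (✓`ringDeficit_combConst_eq_commutator_quartic`).  The Łojasiewicz lane of
LINE g15-B (✓`ToronValleyVolume.Lojasiewicz.exists_flat_ring_near`, exponent `½`) passes THROUGH this family on its way to the flat set; stopping
BEFORE its commuting step gives exponent ONE.  This file packages that first half, for a ring history `P` whose slice `0` is in comb gauge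
(`treeGauge (P.1 0) = 1` — every `X_fix` point), with `δ := √F₀(P)`:

* §1 the COMB SHADOW `K(P) := ((fun _ => combFlat (wrapReps (P.1 0))), fun _ => P.2 0) ∈ C` is per-variable close:
  ★ `fd_slice_combShadow_le` — `fd (P.1 i e) (combFlat (wrapReps (P.1 0)) e) ≤ (4L + 12L²)·δ` (✓`fd_slice_zero_le'`, ✓`fd_treeFix_combFlat_le`),
  ★ `fd_seam_combShadow_le` — `fd (P.2 x) (P.2 0) ≤ 12L²·δ` (the seam field jumps by `≤ 4Lδ` across tree edges, ✓`fd_sub_base_le_of_treeEdge`);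
* §2 the shadow data almost commute: `fd_comm_wraps_le` (`≤ 20L²δ`, ✓`fd_comm_wrapReps_le`), ★ `fd_comm_seam_wrap_le` (`≤ 12L²δ`);
* §3 ★★ `ringDeficit_combShadow_le` — THE SHADOW COSTS AT MOST A POLYNOMIAL: `F₀(K(P)) ≤ 2832·L⁶·F₀(P)` (✓`ringDeficit_combConst_eq_commutator_quartic`
  + ✓`norm_quat_comm_le_fd`) — the zero-mode ("flux") half of the central coercivity;
* §4 ★★ `sum_fd_sq_combShadow_le` — `Σ_{i,e} fd(P.1 i e, K.1 i e)² + Σ_x fd(P.2 x, P.2 0)² ≤ 1680·L⁸·F₀(P)` — the transverse half w.r.t. the family `C`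
  (NO additive `ρ`-term: compare ✓`FixFrame.exists_central_comb_near_of_central_of_treeGauge_eq_one`, which goes to the central POINT and pays `+4ρ`),
  and the quaternion form `sum_norm_sq_combShadow_le`.

Part II (`…VirialFluxGapCentralCoercivity`) transfers both halves from `K(P)` to `π_C(P)` under the central sign hypotheses.

HONEST LABEL: classical lattice inequalities (zero ℏ), helpers for a RECORD-label crux of a DRAFT route; the Euler field is NOT assembled; ⟨24141⟩ and
⟨22884⟩ stay OPEN; no stub ∕ crux ∕ rung ∕ summit is closed; the Yang–Mills mass gap is NOT proved by this; no summit is proved by a line.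
THEOREMS ONLY (no `def`, no `sorry`); the shadow is written as a lambda.

References: M. Lüscher, Nucl. Phys. B 219 (1983) 233–261, §2 (torons, comb representatives) [Luscher1983]; E. Seiler, LNP 159 (1982), §2 (tree
gauge) [SeilerLNP1982]; A. Coste, A. González-Arroyo, J. Jurkiewicz, C. P. Korthals Altes, Nucl. Phys. B 262 (1985) 67–94 (zero-mode quartic)
[CosteEtAl1985].
-/

set_option autoImplicit false

noncomputable section

open scoped Quaternion Matrix BigOperators
open Literature.MathematicalPhysics.QuantumFieldTheory hiding SU2
open Literature.MathematicalPhysics.QuantumLattice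

namespace Summit.QuantumFields.YangMills.Theorems.VirialFluxGap.CentralCoercivity

open Summit.QuantumFields.YangMills.Theorems.FemtoTransferGap
open Summit.QuantumFields.YangMills.Theorems.FemtoTransferGap.TT
open Summit.QuantumFields.YangMills.Theorems.FemtoTransferGap.TwoLattice
open Summit.QuantumFields.YangMills.Theorems.FemtoTransferGap.TwoLattice.Flat
open Summit.QuantumFields.YangMills.Theorems.FemtoTransferGap.TwoLattice.Cov
open Summit.QuantumFields.YangMills.Theorems.VirialFluxGap.RingDeficit
open Summit.QuantumFields.YangMills.Theorems.VirialFluxGap.CombConstant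
open Summit.QuantumFields.YangMills.Theorems.ToronValleyVolume.Lojasiewicz

variable {L : ℕ} [NeZero L]

/-! ## §1 The comb shadow is per-variable close -/

omit [NeZero L] in
/-- In comb gauge the comb-gauge fixing is the identity: `treeGauge U = 1 ⇒ treeFix U = U`. [cite: SeilerLNP1982, §2] -/
theorem treeFix_eq_self_of_treeGauge_eq_one {U : GaugeConfig 3 L SU2} (ht : treeGauge U = 1) : treeFix U = U := by
  show gaugeTransform (treeGauge U) U = U
  rw [ht, gaugeTransform_one']

/-- In comb gauge the tree links are `1`. [cite: SeilerLNP1982, §2] -/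
theorem apply_eq_one_of_treeGauge_eq_one {U : GaugeConfig 3 L SU2} (ht : treeGauge U = 1) {e : Edge 3 L} (he : treeEdge e = true) :
    U e = 1 := by
  have h := treeFix_eq_one_of_treeEdge U he
  rwa [treeFix_eq_self_of_treeGauge_eq_one ht] at h

/-- `(L−1)(6L−4)·√(2S(P₀)) ≤ 12L²·√F₀(P)`: the comb-propagation radius of slice `0` in units of the ring deficit. [folklore] -/
theorem comb_radius_le (P : (Fin (2 * L - 1 + 1) → GaugeConfig 3 L SU2) × (Site 3 L → SU2)) :
    ((L : ℝ) - 1) * ((6 * (L : ℝ) - 4) * Real.sqrt (2 * wilsonAction su2Rep (P.1 0))) ≤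
      12 * (L : ℝ) ^ 2 * Real.sqrt (ringDeficit L (fun _ => false) P) := by
  set δ := Real.sqrt (ringDeficit L (fun _ => false) P) with hδ
  have hδ0 : 0 ≤ δ := Real.sqrt_nonneg _
  have hL1 : (1 : ℝ) ≤ L := by exact_mod_cast NeZero.one_le
  have hL0 : (0 : ℝ) ≤ (L : ℝ) - 1 := by linarith
  have hS : Real.sqrt (2 * wilsonAction su2Rep (P.1 0)) ≤ 2 * δ := sqrt_two_action_le P
  have h1 : ((L : ℝ) - 1) * ((6 * (L : ℝ) - 4) * Real.sqrt (2 * wilsonAction su2Rep (P.1 0))) ≤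
      ((L : ℝ) - 1) * ((6 * (L : ℝ) - 4) * (2 * δ)) :=
    mul_le_mul_of_nonneg_left (mul_le_mul_of_nonneg_left hS (by linarith)) hL0
  nlinarith [h1, mul_nonneg hL0 hδ0]

/-- ★ **Slices versus the comb shadow.**  With slice `0` in comb gauge, every slice of `P` is within `(4L + 12L²)·√F₀(P)` (Frobenius, per link) of the
comb-flat configuration `combFlat (wrapReps (P.1 0))` built from its OWN wrap representatives. [cite: Luscher1983, §2] -/
theorem fd_slice_combShadow_le (P : (Fin (2 * L - 1 + 1) → GaugeConfig 3 L SU2) × (Site 3 L → SU2)) (ht : treeGauge (P.1 0) = 1)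
    (i : Fin (2 * L - 1 + 1)) (e : Edge 3 L) :
    fd (P.1 i e) (combFlat (wrapReps (P.1 0)) e) ≤
      (4 * (L : ℝ) + 12 * (L : ℝ) ^ 2) * Real.sqrt (ringDeficit L (fun _ => false) P) := by
  have h1 := fd_slice_zero_le' P i e
  have h2 : fd (P.1 0 e) (combFlat (wrapReps (P.1 0)) e) ≤ 12 * (L : ℝ) ^ 2 * Real.sqrt (ringDeficit L (fun _ => false) P) := by
    have h := fd_treeFix_combFlat_le (P.1 0) e
    rw [treeFix_eq_self_of_treeGauge_eq_one ht] at h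
    exact h.trans (comb_radius_le P)
  calc fd (P.1 i e) (combFlat (wrapReps (P.1 0)) e) ≤ fd (P.1 i e) (P.1 0 e) + fd (P.1 0 e) (combFlat (wrapReps (P.1 0)) e) := fd_triangle _ _ _
    _ ≤ 4 * (L : ℝ) * Real.sqrt (ringDeficit L (fun _ => false) P) + 12 * (L : ℝ) ^ 2 * Real.sqrt (ringDeficit L (fun _ => false) P) :=
        add_le_add h1 h2
    _ = (4 * (L : ℝ) + 12 * (L : ℝ) ^ 2) * Real.sqrt (ringDeficit L (fun _ => false) P) := by ring

/-- The seam gauge field of a ring history in comb gauge jumps by at most `4L√F₀` across every TREE edge of the comb. [cite: SeilerLNP1982, §2] -/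
theorem fd_seam_jump_le (P : (Fin (2 * L - 1 + 1) → GaugeConfig 3 L SU2) × (Site 3 L → SU2)) (ht : treeGauge (P.1 0) = 1)
    (e : Edge 3 L) (he : treeEdge e = true) :
    fd (P.2 (e.1.shift e.2)) (P.2 e.1) ≤ 4 * (L : ℝ) * Real.sqrt (ringDeficit L (fun _ => false) P) := by
  have h1 := fd_seam_zero_le P e
  have hU : P.1 0 e = 1 := apply_eq_one_of_treeGauge_eq_one ht he
  have e1 : gaugeTransform P.2 (P.1 0) e = P.2 e.1 * (P.2 (e.1.shift e.2))⁻¹ := by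
    rw [show gaugeTransform P.2 (P.1 0) e = P.2 e.1 * P.1 0 e * (P.2 (e.1.shift e.2))⁻¹ from rfl, hU, mul_one]
  rw [hU, e1, fd_comm, fd_mul_inv_one] at h1
  rwa [fd_comm]

/-- ★ **The seam field versus its base value.**  With slice `0` in comb gauge, `fd (P.2 x) (P.2 0) ≤ 12L²·√F₀(P)` at every site (comb path of
`≤ 3(L−1)` tree edges, ✓`fd_sub_base_le_of_treeEdge`). [cite: SeilerLNP1982, §2] -/
theorem fd_seam_combShadow_le (P : (Fin (2 * L - 1 + 1) → GaugeConfig 3 L SU2) × (Site 3 L → SU2)) (ht : treeGauge (P.1 0) = 1)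
    (x : Site 3 L) :
    fd (P.2 x) (P.2 0) ≤ 12 * (L : ℝ) ^ 2 * Real.sqrt (ringDeficit L (fun _ => false) P) := by
  set δ := Real.sqrt (ringDeficit L (fun _ => false) P) with hδ
  have hδ0 : 0 ≤ δ := Real.sqrt_nonneg _
  have hL1 : (1 : ℝ) ≤ L := by exact_mod_cast NeZero.one_le
  have hρ0 : 0 ≤ 4 * (L : ℝ) * δ := by positivity
  have h := fd_sub_base_le_of_treeEdge hρ0 (fun e he => fd_seam_jump_le P ht e he) x
  calc fd (P.2 x) (P.2 0) ≤ 3 * ((L : ℝ) - 1) * (4 * (L : ℝ) * δ) := h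
    _ ≤ 12 * (L : ℝ) ^ 2 * δ := by nlinarith [mul_nonneg (by linarith : (0 : ℝ) ≤ (L : ℝ) - 1) hδ0]

/-! ## §2 The shadow data almost commute -/

/-- The wrap representatives of slice `0` almost commute: `fd([w_i,w_j], 1) ≤ 20L²·√F₀(P)` (no gauge hypothesis). [cite: Luscher1983, §2] -/
theorem fd_comm_wraps_le (P : (Fin (2 * L - 1 + 1) → GaugeConfig 3 L SU2) × (Site 3 L → SU2)) (i j : Fin 3) :
    fd (wrapReps (P.1 0) i * wrapReps (P.1 0) j * (wrapReps (P.1 0) i)⁻¹ * (wrapReps (P.1 0) j)⁻¹) 1 ≤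
      20 * (L : ℝ) ^ 2 * Real.sqrt (ringDeficit L (fun _ => false) P) := by
  set δ := Real.sqrt (ringDeficit L (fun _ => false) P) with hδ
  have hδ0 : 0 ≤ δ := Real.sqrt_nonneg _
  have hL1 : (1 : ℝ) ≤ L := by exact_mod_cast NeZero.one_le
  have hS : Real.sqrt (2 * wilsonAction su2Rep (P.1 0)) ≤ 2 * δ := sqrt_two_action_le P
  refine (fd_comm_wrapReps_le (P.1 0) i j).trans ?_
  have hC : combC L ≤ 10 * (L : ℝ) ^ 2 := by unfold combC; nlinarith
  have hC0 : 0 ≤ combC L := le_trans zero_le_one one_le_combC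
  calc combC L * Real.sqrt (2 * wilsonAction su2Rep (P.1 0)) ≤ combC L * (2 * δ) := mul_le_mul_of_nonneg_left hS hC0
    _ ≤ 10 * (L : ℝ) ^ 2 * (2 * δ) := mul_le_mul_of_nonneg_right hC (by positivity)
    _ = 20 * (L : ℝ) ^ 2 * δ := by ring

/-- ★ **The seam base value almost commutes with the wraps**: `fd(c·w_k·c⁻¹·w_k⁻¹, 1) ≤ 12L²·√F₀(P)`, `c = P.2 0`, slice `0` in comb gauge (the
three wrap edges END at the origin, ✓`wrapEdge_shift`). [cite: Luscher1983, §2] -/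
theorem fd_comm_seam_wrap_le (P : (Fin (2 * L - 1 + 1) → GaugeConfig 3 L SU2) × (Site 3 L → SU2)) (ht : treeGauge (P.1 0) = 1)
    (k : Fin 3) :
    fd (P.2 0 * wrapReps (P.1 0) k * (P.2 0)⁻¹ * (wrapReps (P.1 0) k)⁻¹) 1 ≤
      12 * (L : ℝ) ^ 2 * Real.sqrt (ringDeficit L (fun _ => false) P) := by
  set δ := Real.sqrt (ringDeficit L (fun _ => false) P) with hδ
  have hδ0 : 0 ≤ δ := Real.sqrt_nonneg _
  have hL1 : (1 : ℝ) ≤ L := by exact_mod_cast NeZero.one_le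
  set U : GaugeConfig 3 L SU2 := P.1 0 with hU
  set g : Site 3 L → SU2 := P.2 with hg
  set c : SU2 := g 0 with hc
  set w : Fin 3 → SU2 := wrapReps U with hw
  set m : Site 3 L := mk3 (if k = 0 then (-1 : ZMod L) else 0) (if k = 1 then (-1 : ZMod L) else 0) (if k = 2 then (-1 : ZMod L) else 0) with hm
  have hwk : w k = U (m, k) := by rw [hw, wrapReps_eq, treeFix_eq_self_of_treeGauge_eq_one ht]
  have hshift : m.shift k = 0 := wrapEdge_shift k
  -- the seam image of the wrap edge: `g m · w_k · c⁻¹`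
  have h1 : fd (U (m, k)) (gaugeTransform g U (m, k)) ≤ 4 * (L : ℝ) * δ := fd_seam_zero_le P (m, k)
  have e1 : gaugeTransform g U (m, k) = g m * w k * c⁻¹ := by
    rw [show gaugeTransform g U (m, k) = g m * U (m, k) * (g (m.shift k))⁻¹ from rfl, hshift, ← hwk]
  rw [e1, ← hwk] at h1
  have h2 : fd (g m * w k * c⁻¹) (c * w k * c⁻¹) = fd (g m) c := by rw [fd_mul_right, fd_mul_right]
  have h3 : fd (g m) c ≤ 12 * (L : ℝ) ^ 2 * δ - 4 * (L : ℝ) * δ := by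
    have hρ0 : 0 ≤ 4 * (L : ℝ) * δ := by positivity
    have h := fd_sub_base_le_of_treeEdge hρ0 (fun e he => fd_seam_jump_le P ht e he) m
    calc fd (g m) c ≤ 3 * ((L : ℝ) - 1) * (4 * (L : ℝ) * δ) := h
      _ = 12 * (L : ℝ) ^ 2 * δ - 12 * (L : ℝ) * δ := by ring
      _ ≤ 12 * (L : ℝ) ^ 2 * δ - 4 * (L : ℝ) * δ := by nlinarith [mul_nonneg (by linarith : (0 : ℝ) ≤ (L : ℝ)) hδ0]
  rw [fd_mul_inv_one, fd_comm]
  calc fd (w k) (c * w k * c⁻¹) ≤ fd (w k) (g m * w k * c⁻¹) + fd (g m * w k * c⁻¹) (c * w k * c⁻¹) := fd_triangle _ _ _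
    _ ≤ 4 * (L : ℝ) * δ + (12 * (L : ℝ) ^ 2 * δ - 4 * (L : ℝ) * δ) := by rw [h2]; exact add_le_add h1 h3
    _ = 12 * (L : ℝ) ^ 2 * δ := by ring

/-- The same commutator in the order `[w_k, c]`. [folklore] -/
theorem fd_comm_wrap_seam_le (P : (Fin (2 * L - 1 + 1) → GaugeConfig 3 L SU2) × (Site 3 L → SU2)) (ht : treeGauge (P.1 0) = 1)
    (k : Fin 3) :
    fd (wrapReps (P.1 0) k * P.2 0 * (wrapReps (P.1 0) k)⁻¹ * (P.2 0)⁻¹) 1 ≤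
      12 * (L : ℝ) ^ 2 * Real.sqrt (ringDeficit L (fun _ => false) P) := by
  have hinv : ∀ a b : SU2, fd (b * a * b⁻¹ * a⁻¹) 1 = fd (a * b * a⁻¹ * b⁻¹) 1 := fun a b => by
    rw [show b * a * b⁻¹ * a⁻¹ = (a * b * a⁻¹ * b⁻¹)⁻¹ by group, ← fd_inv, inv_inv, inv_one]
  rw [← hinv]
  exact fd_comm_seam_wrap_le P ht k

/-! ## §3 The shadow costs at most a polynomial -/

/-- `‖q(a)q(b) − q(b)q(a)‖² ≤ fd([a,b], 1)²`. [folklore] -/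
theorem norm_quat_comm_sq_le (a b : SU2) :
    ‖su2Quat a * su2Quat b - su2Quat b * su2Quat a‖ ^ 2 ≤ fd (a * b * a⁻¹ * b⁻¹) 1 ^ 2 :=
  pow_le_pow_left₀ (norm_nonneg _) (norm_quat_comm_le_fd a b) 2

/-- ★★ **THE COMB SHADOW COSTS AT MOST A POLYNOMIAL**: with slice `0` in comb gauge,
`F₀((fun _ => combFlat (wrapReps (P.1 0))), fun _ => P.2 0) ≤ 2832·L⁶·F₀(P)` — the zero-mode half of the central coercivity: the commutator
quartic of the shadow data (✓`ringDeficit_combConst_eq_commutator_quartic`, weights `2L², L²`) is `≤ 2L²·3·(20L²δ)² + L²·3·(12L²δ)²`,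
`δ² = F₀(P)`. [cite: CosteEtAl1985] -/
theorem ringDeficit_combShadow_le (P : (Fin (2 * L - 1 + 1) → GaugeConfig 3 L SU2) × (Site 3 L → SU2)) (ht : treeGauge (P.1 0) = 1) :
    ringDeficit L (fun _ => false)
        ((fun _ : Fin (2 * L - 1 + 1) => combFlat (L := L) (wrapReps (P.1 0)), fun _ : Site 3 L => P.2 0) :
          (Fin (2 * L - 1 + 1) → GaugeConfig 3 L SU2) × (Site 3 L → SU2)) ≤
      2832 * (L : ℝ) ^ 6 * ringDeficit L (fun _ => false) P := by
  set F := ringDeficit L (fun _ => false) P with hF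
  set δ := Real.sqrt F with hδ
  have hF0 : 0 ≤ F := ringDeficit_nonneg _ P
  have hδ2 : δ ^ 2 = F := Real.sq_sqrt hF0
  have hδ0 : 0 ≤ δ := Real.sqrt_nonneg _
  have hL0 : (0 : ℝ) ≤ L := Nat.cast_nonneg _
  set w := wrapReps (P.1 0) with hw
  set c := P.2 0 with hc
  have hww : ∀ p : {p : Fin 3 × Fin 3 // p.1 < p.2},
      ‖su2Quat (w p.1.1) * su2Quat (w p.1.2) - su2Quat (w p.1.2) * su2Quat (w p.1.1)‖ ^ 2 ≤ (20 * (L : ℝ) ^ 2 * δ) ^ 2 := fun p =>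
    (norm_quat_comm_sq_le _ _).trans (pow_le_pow_left₀ (by unfold fd; exact frobNorm_nonneg _) (fd_comm_wraps_le P p.1.1 p.1.2) 2)
  have hwc : ∀ k : Fin 3, ‖su2Quat (w k) * su2Quat c - su2Quat c * su2Quat (w k)‖ ^ 2 ≤ (12 * (L : ℝ) ^ 2 * δ) ^ 2 := fun k =>
    (norm_quat_comm_sq_le _ _).trans (pow_le_pow_left₀ (by unfold fd; exact frobNorm_nonneg _) (fd_comm_wrap_seam_le P ht k) 2)
  have hcard : (Finset.univ : Finset {p : Fin 3 × Fin 3 // p.1 < p.2}).card = 3 := by decide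
  have hs1 : ∑ p : {p : Fin 3 × Fin 3 // p.1 < p.2},
      ‖su2Quat (w p.1.1) * su2Quat (w p.1.2) - su2Quat (w p.1.2) * su2Quat (w p.1.1)‖ ^ 2 ≤ 3 * (20 * (L : ℝ) ^ 2 * δ) ^ 2 := by
    calc ∑ p : {p : Fin 3 × Fin 3 // p.1 < p.2}, ‖su2Quat (w p.1.1) * su2Quat (w p.1.2) - su2Quat (w p.1.2) * su2Quat (w p.1.1)‖ ^ 2
        ≤ ∑ _p : {p : Fin 3 × Fin 3 // p.1 < p.2}, (20 * (L : ℝ) ^ 2 * δ) ^ 2 := Finset.sum_le_sum fun p _ => hww p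
      _ = 3 * (20 * (L : ℝ) ^ 2 * δ) ^ 2 := by rw [Finset.sum_const, hcard, nsmul_eq_mul]; norm_num
  have hs2 : ∑ k : Fin 3, ‖su2Quat (w k) * su2Quat c - su2Quat c * su2Quat (w k)‖ ^ 2 ≤ 3 * (12 * (L : ℝ) ^ 2 * δ) ^ 2 := by
    calc ∑ k : Fin 3, ‖su2Quat (w k) * su2Quat c - su2Quat c * su2Quat (w k)‖ ^ 2
        ≤ ∑ _k : Fin 3, (12 * (L : ℝ) ^ 2 * δ) ^ 2 := Finset.sum_le_sum fun k _ => hwc k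
      _ = 3 * (12 * (L : ℝ) ^ 2 * δ) ^ 2 := by rw [Finset.sum_const, Finset.card_univ, Fintype.card_fin, nsmul_eq_mul]; norm_num
  rw [ringDeficit_combConst_eq_commutator_quartic]
  have h2 : 0 ≤ 2 * (L : ℝ) ^ 2 := by positivity
  have h1 : 0 ≤ (L : ℝ) ^ 2 := by positivity
  calc 2 * (L : ℝ) ^ 2 * ∑ p : {p : Fin 3 × Fin 3 // p.1 < p.2},
          ‖su2Quat (w p.1.1) * su2Quat (w p.1.2) - su2Quat (w p.1.2) * su2Quat (w p.1.1)‖ ^ 2 +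
        (L : ℝ) ^ 2 * ∑ k : Fin 3, ‖su2Quat (w k) * su2Quat c - su2Quat c * su2Quat (w k)‖ ^ 2
      ≤ 2 * (L : ℝ) ^ 2 * (3 * (20 * (L : ℝ) ^ 2 * δ) ^ 2) + (L : ℝ) ^ 2 * (3 * (12 * (L : ℝ) ^ 2 * δ) ^ 2) :=
        add_le_add (mul_le_mul_of_nonneg_left hs1 h2) (mul_le_mul_of_nonneg_left hs2 h1)
    _ = 2832 * (L : ℝ) ^ 6 * δ ^ 2 := by ring
    _ = 2832 * (L : ℝ) ^ 6 * F := by rw [hδ2]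

/-! ## §4 Squared sums: the transverse half with respect to the family `C` -/

omit [NeZero L] in
/-- `4L + 12L² ≤ 16L²` for `L ≥ 1`. [folklore] -/
theorem four_add_twelve_sq_le (hL : (1 : ℝ) ≤ L) : 4 * (L : ℝ) + 12 * (L : ℝ) ^ 2 ≤ 16 * (L : ℝ) ^ 2 := by nlinarith

/-- ★★ **Transverse proximity to the comb-constant family, exponent ONE.**  With slice `0` in comb gauge,
`Σ_{i,e} fd(P.1 i e, combFlat (wrapReps (P.1 0)) e)² + Σ_x fd(P.2 x, P.2 0)² ≤ 1680·L⁸·F₀(P)` (`2L·3L³` links at `(16L²δ)²`, `L³` sites at `(12L²δ)²`).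
[cite: Luscher1983, §2] -/
theorem sum_fd_sq_combShadow_le (P : (Fin (2 * L - 1 + 1) → GaugeConfig 3 L SU2) × (Site 3 L → SU2)) (ht : treeGauge (P.1 0) = 1) :
    (∑ i : Fin (2 * L - 1 + 1), ∑ e : Edge 3 L, fd (P.1 i e) (combFlat (wrapReps (P.1 0)) e) ^ 2) +
        ∑ x : Site 3 L, fd (P.2 x) (P.2 0) ^ 2 ≤
      1680 * (L : ℝ) ^ 8 * ringDeficit L (fun _ => false) P := by
  set F := ringDeficit L (fun _ => false) P with hF
  set δ := Real.sqrt F with hδ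
  have hF0 : 0 ≤ F := ringDeficit_nonneg _ P
  have hδ2 : δ ^ 2 = F := Real.sq_sqrt hF0
  have hδ0 : 0 ≤ δ := Real.sqrt_nonneg _
  have hL1 : (1 : ℝ) ≤ L := by exact_mod_cast NeZero.one_le
  have hL0 : (0 : ℝ) ≤ L := by linarith
  have hfd0 : ∀ a b : SU2, 0 ≤ fd a b := fun a b => by unfold fd; exact frobNorm_nonneg _
  have hcardI : (Fintype.card (Fin (2 * L - 1 + 1)) : ℝ) = 2 * (L : ℝ) := by
    rw [Fintype.card_fin]
    have hL : 1 ≤ L := NeZero.one_le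
    rw [show 2 * L - 1 + 1 = 2 * L by omega]; push_cast; ring
  have hcardS : (Fintype.card (Site 3 L) : ℝ) = (L : ℝ) ^ 3 := by
    rw [Fintype.card_pi, Finset.prod_const, Finset.card_univ, Fintype.card_fin, ZMod.card]; push_cast; ring
  have hs1 : ∀ (i : Fin (2 * L - 1 + 1)) (e : Edge 3 L), fd (P.1 i e) (combFlat (wrapReps (P.1 0)) e) ^ 2 ≤ (16 * (L : ℝ) ^ 2 * δ) ^ 2 :=
    fun i e => pow_le_pow_left₀ (hfd0 _ _) ((fd_slice_combShadow_le P ht i e).trans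
      (mul_le_mul_of_nonneg_right (four_add_twelve_sq_le hL1) hδ0)) 2
  have hs2 : ∀ x : Site 3 L, fd (P.2 x) (P.2 0) ^ 2 ≤ (12 * (L : ℝ) ^ 2 * δ) ^ 2 := fun x =>
    pow_le_pow_left₀ (hfd0 _ _) (fd_seam_combShadow_le P ht x) 2
  have hA : (∑ i : Fin (2 * L - 1 + 1), ∑ e : Edge 3 L, fd (P.1 i e) (combFlat (wrapReps (P.1 0)) e) ^ 2) ≤
      2 * (L : ℝ) * (3 * (L : ℝ) ^ 3 * (16 * (L : ℝ) ^ 2 * δ) ^ 2) := by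
    have hin : ∀ i : Fin (2 * L - 1 + 1), ∑ e : Edge 3 L, fd (P.1 i e) (combFlat (wrapReps (P.1 0)) e) ^ 2 ≤
        3 * (L : ℝ) ^ 3 * (16 * (L : ℝ) ^ 2 * δ) ^ 2 := fun i =>
      calc ∑ e : Edge 3 L, fd (P.1 i e) (combFlat (wrapReps (P.1 0)) e) ^ 2 ≤ ∑ _e : Edge 3 L, (16 * (L : ℝ) ^ 2 * δ) ^ 2 :=
            Finset.sum_le_sum fun e _ => hs1 i e
        _ = 3 * (L : ℝ) ^ 3 * (16 * (L : ℝ) ^ 2 * δ) ^ 2 := by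
            rw [Finset.sum_const, Finset.card_univ, nsmul_eq_mul, ConstTube.card_edge_three L]
    calc (∑ i : Fin (2 * L - 1 + 1), ∑ e : Edge 3 L, fd (P.1 i e) (combFlat (wrapReps (P.1 0)) e) ^ 2)
        ≤ ∑ _i : Fin (2 * L - 1 + 1), 3 * (L : ℝ) ^ 3 * (16 * (L : ℝ) ^ 2 * δ) ^ 2 := Finset.sum_le_sum fun i _ => hin i
      _ = 2 * (L : ℝ) * (3 * (L : ℝ) ^ 3 * (16 * (L : ℝ) ^ 2 * δ) ^ 2) := by rw [Finset.sum_const, Finset.card_univ, nsmul_eq_mul, hcardI]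
  have hB : ∑ x : Site 3 L, fd (P.2 x) (P.2 0) ^ 2 ≤ (L : ℝ) ^ 3 * (12 * (L : ℝ) ^ 2 * δ) ^ 2 := by
    calc ∑ x : Site 3 L, fd (P.2 x) (P.2 0) ^ 2 ≤ ∑ _x : Site 3 L, (12 * (L : ℝ) ^ 2 * δ) ^ 2 := Finset.sum_le_sum fun x _ => hs2 x
      _ = (L : ℝ) ^ 3 * (12 * (L : ℝ) ^ 2 * δ) ^ 2 := by rw [Finset.sum_const, Finset.card_univ, nsmul_eq_mul, hcardS]
  have hL78 : (L : ℝ) ^ 7 ≤ (L : ℝ) ^ 8 := pow_le_pow_right₀ hL1 (by norm_num)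
  calc (∑ i : Fin (2 * L - 1 + 1), ∑ e : Edge 3 L, fd (P.1 i e) (combFlat (wrapReps (P.1 0)) e) ^ 2) + ∑ x : Site 3 L, fd (P.2 x) (P.2 0) ^ 2
      ≤ 2 * (L : ℝ) * (3 * (L : ℝ) ^ 3 * (16 * (L : ℝ) ^ 2 * δ) ^ 2) + (L : ℝ) ^ 3 * (12 * (L : ℝ) ^ 2 * δ) ^ 2 := add_le_add hA hB
    _ = (1536 * (L : ℝ) ^ 8 + 144 * (L : ℝ) ^ 7) * δ ^ 2 := by ring
    _ ≤ (1536 * (L : ℝ) ^ 8 + 144 * (L : ℝ) ^ 8) * δ ^ 2 := by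
        refine mul_le_mul_of_nonneg_right ?_ (sq_nonneg _); linarith
    _ = 1680 * (L : ℝ) ^ 8 * F := by rw [hδ2]; ring

/-- ★★ The same in unit quaternions (`‖q V − q W‖ ≤ fd V W`, ✓`norm_su2Quat_sub_le_fd`):
`Σ_{i,e} ‖q(P.1 i e) − q(K.1 i e)‖² + Σ_x ‖q(P.2 x) − q(P.2 0)‖² ≤ 1680·L⁸·F₀(P)`. [cite: Luscher1983, §2] -/
theorem sum_norm_sq_combShadow_le (P : (Fin (2 * L - 1 + 1) → GaugeConfig 3 L SU2) × (Site 3 L → SU2)) (ht : treeGauge (P.1 0) = 1) :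
    (∑ i : Fin (2 * L - 1 + 1), ∑ e : Edge 3 L, ‖su2Quat (P.1 i e) - su2Quat (combFlat (wrapReps (P.1 0)) e)‖ ^ 2) +
        ∑ x : Site 3 L, ‖su2Quat (P.2 x) - su2Quat (P.2 0)‖ ^ 2 ≤
      1680 * (L : ℝ) ^ 8 * ringDeficit L (fun _ => false) P := by
  refine le_trans (add_le_add (Finset.sum_le_sum fun i _ => Finset.sum_le_sum fun e _ => ?_) (Finset.sum_le_sum fun x _ => ?_))
    (sum_fd_sq_combShadow_le P ht)
  · exact pow_le_pow_left₀ (norm_nonneg _) (norm_su2Quat_sub_le_fd _ _) 2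
  · exact pow_le_pow_left₀ (norm_nonneg _) (norm_su2Quat_sub_le_fd _ _) 2

end Summit.QuantumFields.YangMills.Theorems.VirialFluxGap.CentralCoercivity

end
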